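import Mathlib
import Summits.CriticalPhenomena.CardyFormulaZ2.Theorems.CardySelfRefinementDefs
import Summits.CriticalPhenomena.CardyFormulaZ2.Theorems.CardySelfRefinementRussoDriftModel
import Summits.CriticalPhenomena.CardyFormulaZ2.Theorems.CardySelfRefinementGradientComparabilityStubJointCrossingNondegenerate
import Summits.CriticalPhenomena.CardyFormulaZ2.Theorems.CardySelfRefinementGradientComparabilityStubBoundaryValuesHi
import Literature.Probability.Percolation.SelfRefinementMeasure
import Literature.Probability.Percolation.RSWChainingInputs
import HarnessLib

/-!
# (N-lo) Uniform lower non-degeneracy of the joint crossing probability along an RSW path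

Crux `stmt-CriticalPhenomena-10269`
(`Summit.CriticalPhenomena.CardyFormulaZ2.Theses.CardySelfRefinement.GradientComparability`),
line **Sketch**, stub `stub_pathPoint_lower` (input (N-lo) of the proved composition
`kestenDictionary`).  Vocabulary (`M`, `A`, `P`, `PathOK`, `nnSupport`, …) from
`CardySelfRefinementDefs` / `CardySelfRefinementRussoDriftModel`; the tube machinery
(`exists_tube_events`) from the (D1) file `…StubJointCrossingNondegenerate`; the bridge
`M_eq_selfRefinementMeasure` and the crossing criterion `mem_configOf_iff_exists_isCrossing` from
`…StubBoundaryValuesHi`.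

## Mathematics

Fix `k`, an admissible path `γ` (`PathOK k γ`) and a nonempty finite quad family `F`.  The last
clause of `PathOK` at aspect ratio `8` gives constants `c₀ > 0`, `n₀` with two-sided box-crossing
bounds `BoxCrossingBounds (M k (γ s).1 (γ s).2) z 8 c₀ n₀` UNIFORMLY in the path parameter `s`.
For each quad `F i` the (D1) helper `exists_tube_events` gives mesh-independent tube data
`Nᵢ, Pᵢ, sᵢ`: at every mesh `η` with `6η ≤ sᵢ`, open long-way crossings of `2(Nᵢ+1)` explicit
`8n × n` / `n × 8n` rectangles at the integer scale `n = ⌊sᵢ/η⌋₊` force a crossing of `F i` inside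
the drawn open edges of every lattice configuration.  For `η < min (sᵢ/6) (sᵢ/(n₀+1))` the scale
`n` is `≥ n₀`, so each rectangle is crossed with `M_k(γ s)`-probability `≥ c₀`; all these events are
increasing and `M_k(ρ,c)` is positively associated (`isPositivelyAssociated_selfRefinementMeasure`,
Harris–FKG), so the intersection `⋂ᵢ Tᵢ(η)` of all tube events has probability
`≥ v₁ := ∏ᵢ (c₀²)^{Nᵢ+1} > 0`, for every `s`.  On the full-measure set `nnSupport`
(`M_compl_nnSupport`) the Schramm–Smirnov crossing `F i ∈ configOf z η univ ω` is
"some crossing of `F i` lies inside the open edges" (`configOf_squareLatticeEmbedding`,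
`mem_z2QuadConfig_iff_exists_isCrossing`), hence `⋂ᵢ Tᵢ(η) ∩ nnSupport ⊆ A ∩ nnSupport` and
`P = M(A ∩ nnSupport) ≥ v₁` (`P_eq_inter_nnSupport`).  The threshold is
`η₅ := minᵢ min (sᵢ/6) (sᵢ/(n₀+1))` (a minimum over the nonempty index set `Fin m`).
-/

noncomputable section

namespace Summit.CriticalPhenomena.CardyFormulaZ2.Theorems.CardySelfRefinement

open scoped Topology
open Filter Set MeasureTheory
open Literature.Probability.LatticeModels Literature.Probability.Percolation
open Literature.Probability.Percolation.QuadCrossing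
open Summit.CriticalPhenomena.CardyFormulaZ2.Theses.CardySelfRefinement

/-! ## FKG for the route's measure `M k ρ c` -/

/-- `M_k(ρ,c)` is positively associated (Harris–FKG, `isPositivelyAssociated_selfRefinementMeasure`). -/
theorem isPositivelyAssociated_M (k : ℕ) (ρ c : ℝ) : IsPositivelyAssociated (M k ρ c) := by
  rw [M_eq_selfRefinementMeasure]
  exact isPositivelyAssociated_selfRefinementMeasure k ρ c

/-- Finite Harris–FKG in `μ.real` form for a positively associated probability measure and a
`Finset` of increasing measurable events: `∏_{i ∈ s} μ(Eᵢ) ≤ μ(⋂_{i ∈ s} Eᵢ)`. -/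
theorem prod_real_le_biInter_of_posAssoc {Ω : Type*} [MeasurableSpace Ω] [Preorder Ω]
    {μ : Measure Ω} [IsProbabilityMeasure μ] (h : IsPositivelyAssociated μ) {ι : Type*}
    (s : Finset ι) {E : ι → Set Ω} (hE : ∀ i ∈ s, IsUpperSet (E i))
    (hEm : ∀ i ∈ s, MeasurableSet (E i)) :
    ∏ i ∈ s, μ.real (E i) ≤ μ.real (⋂ i ∈ s, E i) := by
  have h1 := h.finset_prod_le_biInter s hE hEm
  have h2 : ∏ i ∈ s, μ.real (E i) = (∏ i ∈ s, μ (E i)).toReal := by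
    rw [ENNReal.toReal_prod]; rfl
  rw [h2]
  exact ENNReal.toReal_mono (measure_ne_top μ _) h1

/-! ## The tube events of a quad, uniformly over positively associated box-crossing measures -/

/-- **RSW for a quad, uniform event form.**  For every quad `Q` there are increasing measurable
events `T η`, an exponent `N` and a size `s > 0` such that: (a) for EVERY positively associated
probability measure `μ` with box-crossing bounds `(c₀, n₀)` at aspect ratio `8` and every mesh
`0 < η < min (s/6) (s/(n₀+1))`, `μ(T η) ≥ (c₀²)^{N+1}`; (b) for `0 < η < s/6`, on `T η` every
lattice configuration has, for every shift `t` with `|re t|, |im t| ≤ 2η`, a crossing `K` of `Q`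
with `K - t` inside its open edges drawn at mesh `η√2`.  (`T η` = open long-way crossings of the
`2(N+1)` rectangles of the tube of `Q` at the integer scale `⌊s/η⌋₊`, `exists_tube_events`.) -/
theorem exists_tube_uniform (Q : Quad (univ : Set ℂ)) :
    ∃ (T : ℝ → Set (BondConfig (Site 2))) (N : ℕ) (s : ℝ), 0 < s ∧
      (∀ η, MeasurableSet (T η)) ∧ (∀ η, IsUpperSet (T η)) ∧
      (∀ (μ : Measure (BondConfig (Site 2))) [IsProbabilityMeasure μ], IsPositivelyAssociated μ →
        ∀ (c₀ : ℝ) (n₀ : ℕ), 0 ≤ c₀ → BoxCrossingBounds μ squareLatticeEmbedding.z 8 c₀ n₀ →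
        ∀ η : ℝ, 0 < η → η < s / 6 → η < s / (n₀ + 1) → (c₀ * c₀) ^ (N + 1) ≤ μ.real (T η)) ∧
      (∀ η : ℝ, 0 < η → η < s / 6 → ∀ t : ℂ, |t.re| ≤ 2 * η → |t.im| ≤ 2 * η →
        ∀ ω ∈ T η, ω ⊆ (zdGraph 2).edgeSet →
          ∃ K, Q.IsCrossing K ∧ ∀ z ∈ K, z - t ∈ openEdgeUnion (η * Real.sqrt 2) ω) := by
  obtain ⟨N, P, s, hs, hev⟩ := exists_tube_events Q
  set RH : ℝ → ℕ → Set (BondConfig (Site 2)) := fun η j =>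
    embRectCrossing (fun v => squareLatticeEmbedding.z v -
      ⟨((P j).re - 3 * s - 2 * η) / η, ((P j).im - s + 2 * η) / η⟩)
      (8 * ⌊s / η⌋₊) ⌊s / η⌋₊ with hRH
  set RV : ℝ → ℕ → Set (BondConfig (Site 2)) := fun η j =>
    embTBCrossing (fun v => squareLatticeEmbedding.z v -
      ⟨((P j).re - s + 2 * η) / η, ((P j).im - 3 * s - 2 * η) / η⟩)
      ⌊s / η⌋₊ (8 * ⌊s / η⌋₊) with hRV
  have hmeas : ∀ η j, MeasurableSet (RH η j ∩ RV η j) := fun η j =>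
    (IsoradialArmExtension.measurableSet_embRectCrossing _ _ _).inter
      (IsoradialArmExtension.measurableSet_embTBCrossing _ _ _)
  have hup : ∀ η j, IsUpperSet (RH η j ∩ RV η j) := fun η j =>
    (isUpperSet_embRectCrossing _ _ _).inter (isUpperSet_embTBCrossing _ _ _)
  -- the integer scale `⌊s/η⌋₊`
  have hscale : ∀ η : ℝ, 0 < η → η < s / 6 →
      6 * η ≤ s ∧ s - η < η * ⌊s / η⌋₊ ∧ η * ⌊s / η⌋₊ ≤ s := by
    intro η hη0 hη6
    rw [lt_div_iff₀ (by norm_num : (0:ℝ) < 6)] at hη6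
    have hfl := Nat.lt_floor_add_one (s / η)
    have hfl' := Nat.floor_le (div_nonneg hs.le hη0.le)
    rw [div_lt_iff₀ hη0] at hfl
    rw [le_div_iff₀ hη0] at hfl'
    exact ⟨by linarith, by linarith, by linarith⟩
  refine ⟨fun η => ⋂ j ∈ Finset.range (N + 1), (RH η j ∩ RV η j), N, s, hs,
    fun η => (Finset.range (N + 1)).measurableSet_biInter fun j _ => hmeas η j,
    fun η => isUpperSet_iInter₂ fun j _ => hup η j, ?_, ?_⟩
  · intro μ _ hμ c₀ n₀ hc₀ hB η hη0 hη6 hηn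
    obtain ⟨-, hn1, -⟩ := hscale η hη0 hη6
    rw [lt_div_iff₀ (by positivity : (0:ℝ) < n₀ + 1)] at hηn
    have hn0 : n₀ ≤ ⌊s / η⌋₊ := by
      have h2 : (n₀ : ℝ) < ⌊s / η⌋₊ := by
        by_contra hcon
        push Not at hcon
        have := mul_le_mul_of_nonneg_left hcon hη0.le
        nlinarith
      exact_mod_cast h2.le
    calc (c₀ * c₀) ^ (N + 1) = ∏ j ∈ Finset.range (N + 1), c₀ * c₀ := by simp
      _ ≤ ∏ j ∈ Finset.range (N + 1), μ.real (RH η j ∩ RV η j) := by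
          refine Finset.prod_le_prod (fun _ _ => by positivity) fun j _ => ?_
          have h1 := (hB _ hn0 ⟨((P j).re - 3 * s - 2 * η) / η, ((P j).im - s + 2 * η) / η⟩).1.1
          have h2 := (hB _ hn0 ⟨((P j).re - s + 2 * η) / η, ((P j).im - 3 * s - 2 * η) / η⟩).2.1
          calc c₀ * c₀ ≤ μ.real (RH η j) * μ.real (RV η j) :=
                mul_le_mul h1 h2 hc₀ measureReal_nonneg
            _ ≤ _ := hμ.real (isUpperSet_embRectCrossing _ _ _) (isUpperSet_embTBCrossing _ _ _)
                (IsoradialArmExtension.measurableSet_embRectCrossing _ _ _)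
                (IsoradialArmExtension.measurableSet_embTBCrossing _ _ _)
      _ ≤ _ := prod_real_le_biInter_of_posAssoc hμ _ (fun j _ => hup η j) fun j _ => hmeas η j
  · intro η hη0 hη6 t htr hti ω hω hωE
    obtain ⟨hηs, hn1, hn2⟩ := hscale η hη0 hη6
    refine hev η hη0 hηs _ hn1 hn2 t htr hti ω hωE fun j hj => ?_
    exact mem_iInter₂.1 hω j (Finset.mem_range.2 (Nat.lt_succ_of_le hj))

/-! ## The stub -/

/-- **(N-lo) UNIFORM LOWER NON-DEGENERACY ALONG THE PATH.**  For an RSW path `γ` and a nonempty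
finite quad family `F`, the joint crossing probability `P_η(γ s)` is bounded below by a constant
`v₁ > 0` for all path parameters `s` and all small meshes: tubes of `8:1` boxes inside each quad
(`exists_tube_events`, mesh-independent data), each crossed with probability `≥ c₀` uniformly in
`s` (`PathOK`, aspect ratio `8`), glued by Harris–FKG for `M_k`
(`isPositivelyAssociated_selfRefinementMeasure`); `P = M_k(A ∩ nnSupport)`
(`P_eq_inter_nnSupport`). -/
theorem stub_pathPoint_lower :
    ∀ k : ℕ, k = 2 ∨ k = 3 → ∀ γ : unitInterval → ℝ × ℝ, PathOK k γ →
      ∀ (m : ℕ) (F : Fin m → Quad (Set.univ : Set ℂ)), 0 < m →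
        ∃ v₁ η₅ : ℝ, 0 < v₁ ∧ 0 < η₅ ∧ ∀ η ∈ Set.Ioo 0 η₅, ∀ s : unitInterval,
          v₁ ≤ P k m F η (γ s).1 (γ s).2 := by
  intro k _hk γ hγ m F hm
  obtain ⟨c₀, hc₀, n₀, hbox⟩ := hγ.2.2.2.2.2.2 8 (by norm_num)
  choose T N sz hsz hTm hTu hTprob hTcross using fun i => exists_tube_uniform (F i)
  -- the mesh threshold: a minimum over the nonempty index set
  set f : Fin m → ℝ := fun i => min (sz i / 6) (sz i / (n₀ + 1)) with hf
  obtain ⟨i₀, -, hi₀⟩ :=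
    Finset.exists_min_image Finset.univ f ⟨⟨0, hm⟩, Finset.mem_univ _⟩
  have hf0 : 0 < f i₀ := by
    have := hsz i₀
    simp only [hf]
    positivity
  refine ⟨∏ i, (c₀ * c₀) ^ (N i + 1), f i₀, Finset.prod_pos fun i _ => by positivity, hf0,
    fun η hη s => ?_⟩
  have hη0 : 0 < η := hη.1
  have hηf : ∀ i, η < sz i / 6 ∧ η < sz i / (n₀ + 1) := fun i => by
    have h := hη.2.trans_le (hi₀ i (Finset.mem_univ _))
    exact ⟨h.trans_le (min_le_left _ _), h.trans_le (min_le_right _ _)⟩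
  haveI : IsProbabilityMeasure (M k (γ s).1 (γ s).2) := isProbabilityMeasure_M k _ _
  have hN : M k (γ s).1 (γ s).2 nnSupportᶜ = 0 := M_compl_nnSupport k _ _
  -- all tubes crossed ⇒ all quads crossed (on the support)
  have hsub : (⋂ i, T i η) ∩ nnSupport ⊆ A m F η ∩ nnSupport := by
    rintro ω ⟨hω, hωN⟩
    refine ⟨fun i => ?_, hωN⟩
    obtain ⟨K, hKQ, hKO⟩ := hTcross i η hη0 (hηf i).1 0 (by simp; positivity)
      (by simp; positivity) ω (mem_iInter.1 hω i) hωN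
    exact (mem_configOf_iff_exists_isCrossing hη0 hωN (F i)).2
      ⟨K, hKQ, fun z hz => by simpa using hKO z hz⟩
  rw [P_eq_inter_nnSupport]
  calc ∏ i, (c₀ * c₀) ^ (N i + 1) ≤ ∏ i, (M k (γ s).1 (γ s).2).real (T i η) :=
        Finset.prod_le_prod (fun i _ => by positivity) fun i _ =>
          hTprob i (M k (γ s).1 (γ s).2) (isPositivelyAssociated_M k _ _) c₀ n₀ hc₀.le (hbox s)
            η hη0 (hηf i).1 (hηf i).2
    _ ≤ (M k (γ s).1 (γ s).2).real (⋂ i, T i η) :=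
        (isPositivelyAssociated_M k _ _).prod_real_le_iInter (fun i => hTu i η) fun i => hTm i η
    _ = (M k (γ s).1 (γ s).2).real ((⋂ i, T i η) ∩ nnSupport) := by
        rw [measureReal_def, measureReal_def, measure_inter_conull hN]
    _ ≤ (M k (γ s).1 (γ s).2).real (A m F η ∩ nnSupport) := measureReal_mono hsub

end Summit.CriticalPhenomena.CardyFormulaZ2.Theorems.CardySelfRefinement

end
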